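import Summits.ResolutionOfSingularities.ResolutionOfSingularities.Theorems.EquisingularLiftEquisingularLiftNatStrictTransformVanishingIdeal
import Literature.AlgebraicGeometry.Resolution.StrictTransformBaseChange
import HarnessLib

/-!
# [OURS · L1 W4.5(b) · EL♮(3) · T23-A′ brick (A′-3b)] Base change of strict transforms: the criterion by REGULAR stalks, and the
# (A′-3)-shaped combination «specialised strict transform = reduced downstairs strict transform»
Crux chain w45b, child EL♮(3) = stmt-ResolutionOfSingularities-20148; T23-A′ = the transversal round-transport brick of res-L1-w45b-stub-4's
widened engine (SIG v2 `L/res-L1-w45b-stub-4/T23Aprime-TransversalTransport.sig.v2.lean` 767f3543c2b2e4ae); (A′-3) «the trace computation» was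
split by res-L1-w45b-plan-1 RULING R13 (2026-08-28T05:55:50Z) into (A′-3b) (res-L1-w45b-lead-1 g12) and (A′-3a) + assembly (res-L1-w45b-stub-2
g12). The first half of (A′-3b) — «the strict transform of a REDUCED closed subscheme under any blow-up is the reduced closed subscheme on
`closure π⁻¹(F ∖ V(C))`» — is ALREADY the tree theorem `strictTransformIdeal_vanishingIdeal_eq` (…NatStrictTransformVanishingIdeal, p532268,
K7a of res-L1-w45b-stub-1's deal); this file supplies the second half and the combination:

* **`strictTransformIdeal_le_of_regular_stalks`** — the strict transform `σ'ᶜ(K') = ⋃ₙ (π'^*K' : (π'^*C')ⁿ)` lies in every ideal sheaf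
  `𝔰 ⊇ π'^*K'` such that at every point of `V(𝔰)` SOME germ of the exceptional ideal `π'^*C'` is a non-zero-divisor modulo `𝔰_z`
  (the tree's `strictTransformIdeal_le_of_prime_stalks`, StrictTransformBaseChange, asks for PRIME stalks not containing the exceptional
  ideal — false for member traces, which may be locally reducible; the one-line argument only needs regularity);
* **`comap_strictTransformIdeal_of_regular_stalks`** — for a commutative square `s ≫ π = π' ≫ t`: `s^*σᶜ(K) = σ'ᶜ(t^*K)` as soon as
  `𝔰 := s^*σᶜ(K)` has the regular-stalk property with respect to `s^*π^*C`;
* **`comap_strictTransformIdeal_eq_vanishingIdeal_closure_of_regular_stalks`** — if moreover `π'` is a blow-up of `t^*C` (special fibre of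
  a blow-up whose centre has property E1) and `t^*K = 𝓘⟨F⟩` (reduced trace), then `s^*σᶜ(K) = 𝓘⟨closure π'⁻¹(F ∖ supp t^*C)⟩` — so
  (A′-3) v2 follows once (A′-3a) supplies the regular-stalk property of the special fibre of the strict transform (stub-4's (e-i′):
  reduced + the equation of `E` regular on it).

Everything is proved; DEF-FREE; no `sorry`; standard axioms. OURS; NOT a statement of any manuscript; AI-written, weaker than expert review.
`--supports stmt-ResolutionOfSingularities-20148 --as helper`. [cite: GortzWedhorn2020, (13.19)] (index only).
-/

set_option linter.dupNamespace false -- mandated namespace `Summit.<Summit>.<Problem>` of this single-conjunct summit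

noncomputable section

open CategoryTheory AlgebraicGeometry TopologicalSpace
open Literature.AlgebraicGeometry.Resolution
open AlgebraicGeometry.Scheme.IdealSheafData

namespace Summit.ResolutionOfSingularities.ResolutionOfSingularities.Cruxes.EquisingularLiftNat.Sections

section Regular

variable {Y' Z' : Scheme.{0}} [IsLocallyNoetherian Z'] {π' : Z' ⟶ Y'}

/-- Powers of an element regular modulo an ideal are regular modulo it. [folklore] -/
theorem pow_mul_mem_imp_of_mul_mem_imp {A : Type*} [CommRing A] {I : Ideal A} {p : A}
    (hreg : ∀ x, p * x ∈ I → x ∈ I) (n : ℕ) (x : A) (hx : p ^ n * x ∈ I) : x ∈ I := by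
  induction n generalizing x with
  | zero => simpa using hx
  | succ n ih =>
    rw [pow_succ, mul_assoc] at hx
    exact hreg x (ih (p * x) hx)

/-- **The strict transform lies in every ideal sheaf `𝔰 ⊇ π'^*K'` modulo whose stalks some exceptional germ is a non-zero-divisor**:
if at every `z ∈ V(𝔰)` there is `p ∈ (π'^*C')_z` with `p·x ∈ 𝔰_z ⇒ x ∈ 𝔰_z`, then `σ'ᶜ(K') = ⋃ₙ (π'^*K' : (π'^*C')ⁿ) ⊆ 𝔰`
(generalises the tree's `strictTransformIdeal_le_of_prime_stalks`). [folklore] -/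
theorem strictTransformIdeal_le_of_regular_stalks (C' K' : Y'.IdealSheafData)
    (𝔰 : Z'.IdealSheafData) (hle : K'.comap π' ≤ 𝔰)
    (hE : ∀ z ∈ 𝔰.support, ∃ p ∈ stalkIdeal (C'.comap π') z,
      ∀ x, p * x ∈ stalkIdeal 𝔰 z → x ∈ stalkIdeal 𝔰 z) :
    strictTransformIdeal π' C' K' ≤ 𝔰 := by
  refine le_of_forall_stalkIdeal_le fun z => ?_
  by_cases hz : z ∈ 𝔰.support
  · obtain ⟨p, hp, hreg⟩ := hE z hz
    intro x hx
    rw [strictTransformIdeal, stalkIdeal_iSup] at hx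
    refine Submodule.iSup_induction (motive := fun x => x ∈ stalkIdeal 𝔰 z) _ hx ?_ (zero_mem _)
      (fun x y hx hy => add_mem hx hy)
    intro n x hx
    rw [stalkIdeal_colon, stalkIdeal_pow] at hx
    have hpn : p ^ n ∈ ((stalkIdeal (C'.comap π') z ^ n : Ideal _) : Set (Z'.presheaf.stalk z)) :=
      Ideal.pow_mem_pow hp n
    have hxp : p ^ n * x ∈ stalkIdeal 𝔰 z := by
      have h := Submodule.mem_colon.mp hx (p ^ n) hpn
      rw [smul_eq_mul, mul_comm] at h
      exact stalkIdeal_mono hle z h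
    exact pow_mul_mem_imp_of_mul_mem_imp hreg n x hxp
  · rw [stalkIdeal_eq_top_of_not_mem_support hz]
    exact le_top

variable {Y Z : Scheme.{0}} (t : Y' ⟶ Y) {π : Z ⟶ Y} {s : Z' ⟶ Z}

/-- **Strict transforms commute with the base change to a fibre, given regular stalks**: for a commutative square `s ≫ π = π' ≫ t`,
if at every point of `V(s^*σᶜ(K))` some germ of the pulled-back exceptional ideal `s^*π^*C` is a non-zero-divisor modulo the stalk of
`s^*σᶜ(K)`, then `s^*σᶜ(K) = σ'ᶜ(t^*K)` (generalises the tree's `comap_strictTransformIdeal_of_prime_stalks`).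
[cite: GortzWedhorn2020, (13.19)] -/
theorem comap_strictTransformIdeal_of_regular_stalks (hsq : s ≫ π = π' ≫ t) (C K : Y.IdealSheafData)
    (hE : ∀ z ∈ ((strictTransformIdeal π C K).comap s).support, ∃ p ∈ stalkIdeal ((C.comap π).comap s) z,
      ∀ x, p * x ∈ stalkIdeal ((strictTransformIdeal π C K).comap s) z → x ∈ stalkIdeal ((strictTransformIdeal π C K).comap s) z) :
    (strictTransformIdeal π C K).comap s = strictTransformIdeal π' (C.comap t) (K.comap t) := by
  refine le_antisymm (comap_strictTransformIdeal_le t hsq C K)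
    (strictTransformIdeal_le_of_regular_stalks _ _ _ ?_ fun z hz => ?_)
  · rw [← comap_comp, ← hsq, comap_comp]
    exact comap_mono _ (comap_le_strictTransformIdeal π C K)
  · rw [← comap_comp, ← hsq, comap_comp]
    exact hE z hz

/-- **(A′-3)-shaped combination — the specialised strict transform of `V(K)` is the REDUCED downstairs strict transform**: for a
commutative square `s ≫ π = π' ≫ t` in which `π'` is a blow-up of `t^*C` (`Y'`, `Z'` locally Noetherian) and `t^*K = 𝓘⟨F⟩` (the reduced
trace of `V(K)`), the regular-stalk property of `s^*σᶜ(K)` gives `s^*σᶜ(K) = 𝓘⟨closure π'⁻¹(F ∖ supp t^*C)⟩`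
(`comap_strictTransformIdeal_of_regular_stalks` + the tree's `strictTransformIdeal_vanishingIdeal_eq`). [folklore] -/
theorem comap_strictTransformIdeal_eq_vanishingIdeal_closure_of_regular_stalks [IsLocallyNoetherian Y']
    (hsq : s ≫ π = π' ≫ t) (C K : Y.IdealSheafData) (hπ' : IsBlowup π' (C.comap t)) (F : Set Y') (hF : IsClosed F)
    (hK : K.comap t = vanishingIdeal ⟨F, hF⟩)
    (hE : ∀ z ∈ ((strictTransformIdeal π C K).comap s).support, ∃ p ∈ stalkIdeal ((C.comap π).comap s) z,
      ∀ x, p * x ∈ stalkIdeal ((strictTransformIdeal π C K).comap s) z → x ∈ stalkIdeal ((strictTransformIdeal π C K).comap s) z) :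
    (strictTransformIdeal π C K).comap s =
      vanishingIdeal (⟨closure (π' ⁻¹' (F \ ((C.comap t).support : Set Y'))), isClosed_closure⟩ : Closeds Z') := by
  rw [comap_strictTransformIdeal_of_regular_stalks t hsq C K hE, hK]
  exact strictTransformIdeal_vanishingIdeal_eq π' (C.comap t) hπ' F hF

end Regular

end Summit.ResolutionOfSingularities.ResolutionOfSingularities.Cruxes.EquisingularLiftNat.Sections

end
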